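import Literature.Analysis.FluidPDE.ForcedOseenRepresentationClassical
import Literature.Analysis.FluidPDE.OseenDuhamelPairCalculus
import Literature.Analysis.FluidPDE.OseenDuhamelEnergyBound
import Literature.Analysis.FluidPDE.KatoLocalBoundedPicard
import HarnessLib

/-!
# Sup-norm stability (continuous dependence on the datum and on the force) of bounded classical
# finite-energy solutions of the forced Navier–Stokes system on `ℝ³` over a closed slab

Analysis/FluidPDE proof file (theorems only; no definitions, no named facts, no `sorry`). It is the
`L^∞` twin of the tree's `L²` stability theorems `exists_l2_stability` /
`exists_l2_stability_forced` (`ClassicalL2Stability(Forced).lean`, Robinson–Rodrigo–Sadowski 2016,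
Thm. 6.10), for two classical solutions with DIFFERENT data and DIFFERENT forces:

Let `(u, p)` and `(u', p')` be classical solutions of the Navier–Stokes system on the closed slab
`[0, T] × ℝ³` with the same viscosity `ν > 0`, driven by jointly continuous, bounded, weakly
divergence-free forces `g`, `g'` with square-integrable slices (e.g. the Leray projections of two
Clay-class forces), both of finite energy and bounded: `‖u‖ ≤ M`, `‖u'‖ ≤ M'` on the slab. If
`‖u'(0) - u(0)‖ ≤ D` everywhere and the heat Duhamel integrals of the two forces differ by at most
`F` on the slab, then for all `t ∈ [0, T]` and every `x`

  `‖u'(t, x) - u(t, x)‖ ≤ 2 (D + F) · exp (36 C₀² (M + M')² t / ν)`,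

`C₀ = oseenSliceConst ℝ³` the slice constant of the Oseen kernel (KNSS 2009, (3.5)):
`sup_stability_forced_core`. Corollaries: `sup_stability_forced` (forces measured in sup norm,
`F = T · sup‖g' − g‖`), `sup_stability_forced_free` (`u` unforced, `g'` measured in `L²`,
`F = 4 ν^{-3/4} T^{1/4} sup_t ‖g'(t)‖₂` — the shape in which a SMALL force of short duration is
absorbed), and the difference form of the representation (`forceDuhamel_sub_of_continuous`).

Mechanism (Leray 1934, §19 (3.4)–(3.8): a-priori control of the sup norm through the integral
equation; Lemarié-Rieusset 2016, Thm. 6.1 (6.12) + Prop. 6.5; Fujita–Kato / Kato 1984 continuity of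
the mild solution map): subtract the forced Oseen representations
`u(t) = e^{νtΔ}u(0) − B^ν_0(u,u)(t) + ∫₀ᵗ e^{ν(t−τ)Δ} g(τ) dτ` of the two solutions
(`IsClassicalNSSolutionOn.ae_eq_forced_oseenMild`), split `B(u',u') − B(u,u) = B(u', w) + B(w, u)`
(`w = u' − u`; the tree's slab bilinearity `oseenDuhamel_sub_left/right`), bound the two bilinear
terms by the slice estimate `‖N_σ[a,b]‖ ≤ C₀ σ^{-1/2} ‖a‖_∞ ‖b‖_∞` against the exponential weight
`e^{λτ}` (`setIntegral_abelKernel_mul_exp_le`: `∫₀ᵗ (t−τ)^{-1/2} e^{λτ} dτ ≤ 3 λ^{-1/2} e^{λt}`), and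
close in the weighted sup norm `sup_{t,x} e^{−λt}‖w(t,x)‖` with `λ = 36 C₀² (M+M')²/ν` (a linear
Abel–Volterra inequality; Ożański–Pooley 2018, Lemma 6.5). No continuity in time of the sup norm
is used — only boundedness of the two solutions.

Consumer: the cell `ns-blowup` (route `PalasekTowerBreakdown`, crux `EpisodeBase`,
stmt-NavierStokesRegularity-19179): the FREE-RUN DOOR — a free classical run from the explicit
level-`0` profile is shadowed, uniformly on the first growth window, by the run under the host's
small fading residual force (FluidComputer companion file). LABEL: Literature port (a-priori
estimate for GIVEN solutions). WHAT THIS IS NOT: not a statement about Navier–Stokes regularity or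
blow-up — continuous dependence over a FIXED slab for solutions assumed classical and bounded there.

## Mathlib / tree search

Tree: `IsClassicalNSSolutionOn.ae_eq_forced_oseenMild` (`ForcedOseenRepresentationClassical`);
`oseenSliceConst`, `norm_oseenSlice_le_oseenSliceConst`, `setIntegral_abelKernel_mul_exp_le`
(`OseenDuhamelPairCalculus`); `oseenDuhamel_sub_left/right` (slab form, `KatoLocalBoundedPicard`);
`norm_forceDuhamel_le`, `integrableOn_forceDuhamelIntegrand_slice` (`ForcedOseenRepresentation`);
`norm_forceDuhamel_le_of_eLpNorm_two` (`OseenDuhamelEnergyBound`);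
`UnboundedOperators.heatExtension_sub_of_bound`, `UnboundedOperators.norm_heatExtension_le`;
`forall_norm_le_of_ae_norm_le`; `integrableOn_sub_rpow_Ioo` (`LerayVolterraComparison`). No sup-norm
continuous-dependence statement existed (`lean search 'stability|contin.*depend'` in FluidPDE:
only the `L²` statements above and the `L³` named fact `GIP2003_L3_stability`).

## References

* J. Leray, *Sur le mouvement d'un liquide visqueux emplissant l'espace*, Acta Math. 63 (1934),
  §19 (3.4)–(3.8), §21 (3.5). [Leray1934]
* P. G. Lemarié-Rieusset, *The Navier–Stokes Problem in the 21st Century*, CRC Press 2016, Thm. 6.1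
  (6.12) with Prop. 6.5, pp. 133–136. [LemarieRieusset2016]
* T. Kato, *Strong `Lᵖ`-solutions of the Navier–Stokes equation in `ℝᵐ`*, Math. Z. 187 (1984)
  471–480, (2.3)–(2.4′). [Kato1984]
* W. S. Ożański, B. C. Pooley, *Leray's fundamental work on the Navier–Stokes equations*, LMS
  Lecture Note Ser. 452 (2018), Lemma 6.5. [OzanskiPooley2018]
* G. Koch, N. Nadirashvili, G. Seregin, V. Šverák, Acta Math. 203 (2009), §3 (3.5).
  [KochNadirashviliSereginSverak2009]
-/

noncomputable section

open MeasureTheory Set Function Filter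
open _root_.Topology
open scoped ENNReal NNReal

namespace Literature.Analysis.FluidPDE

/-! ### Tools: the bilinear term with asymmetric slice bounds at viscosity `ν`, and the
exponentially weighted Abel integral -/

section Tools

variable {E : Type*} [NormedAddCommGroup E] [InnerProductSpace ℝ E] [FiniteDimensional ℝ E]
  [MeasurableSpace E] [BorelSpace E]

/-- **Sup bound of the bilinear term with time-dependent, asymmetric slice bounds, viscosity `ν`**:
if `‖a τ y‖ ≤ M_a(τ)`, `‖b τ y‖ ≤ M_b(τ)` for `τ ∈ (s, t)` and
`τ ↦ (ν(t-τ))^{-1/2} M_a(τ) M_b(τ)` is integrable on `(s, t)`, then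
`‖B^ν_s(a,b)(t)(x)‖ ≤ C₀ ∫_{(s,t)} (ν(t-τ))^{-1/2} M_a(τ) M_b(τ) dτ` (the tree's
`norm_oseenDuhamel_le_setIntegral` is the case `ν = 1`). No measurability is needed.
[cite: KochNadirashviliSereginSverak2009, §3 (3.5) and §4 p. 8 (arXiv:0709.3599v1)] -/
theorem norm_oseenDuhamel_le_setIntegral_visc {ν s t : ℝ} (hν : 0 < ν) {a b : ℝ → E → E}
    {Ma Mb : ℝ → ℝ}
    (ha : ∀ τ ∈ Ioo s t, ∀ y, ‖a τ y‖ ≤ Ma τ) (hb : ∀ τ ∈ Ioo s t, ∀ y, ‖b τ y‖ ≤ Mb τ)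
    (hint : IntegrableOn (fun τ => (ν * (t - τ)) ^ (-(1 / 2 : ℝ)) * (Ma τ * Mb τ)) (Ioo s t))
    (x : E) :
    ‖oseenDuhamel ν s a b t x‖ ≤
      oseenSliceConst E * ∫ τ in Ioo s t, (ν * (t - τ)) ^ (-(1 / 2 : ℝ)) * (Ma τ * Mb τ) := by
  rw [oseenDuhamel_apply, ← integral_const_mul]
  refine norm_integral_le_of_norm_le (hint.const_mul _) ?_
  filter_upwards [ae_restrict_mem measurableSet_Ioo] with τ hτ
  have hσ : 0 < ν * (t - τ) := mul_pos hν (sub_pos.2 hτ.2)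
  calc ‖∫ y, oseenKernel (ν * (t - τ)) (x - y) (a τ y) (b τ y)‖
      = ‖oseenSlice (ν * (t - τ)) (a τ) (b τ) x‖ := by rw [oseenSlice_apply]
    _ ≤ oseenSliceConst E * (ν * (t - τ)) ^ (-(1 / 2 : ℝ)) * Ma τ * Mb τ :=
        norm_oseenSlice_le_oseenSliceConst hσ (ha τ hτ) (hb τ hτ) x
    _ = oseenSliceConst E * ((ν * (t - τ)) ^ (-(1 / 2 : ℝ)) * (Ma τ * Mb τ)) := by ring

omit [MeasurableSpace E] [BorelSpace E] [InnerProductSpace ℝ E] [FiniteDimensional ℝ E] in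
/-- Splitting the viscosity off the Abel kernel: `(ν(t-τ))^{-1/2} = ν^{-1/2} (t-τ)^{-1/2}` for
`τ < t`, `ν ≥ 0`. [folklore] -/
private theorem visc_abelKernel_eq {ν t τ : ℝ} (hν : 0 ≤ ν) (hτ : τ ≤ t) :
    (ν * (t - τ)) ^ (-(1 / 2 : ℝ)) = ν ^ (-(1 / 2 : ℝ)) * (t - τ) ^ (-(1 / 2 : ℝ)) :=
  Real.mul_rpow hν (sub_nonneg.2 hτ)

/-- **The exponentially weighted Abel integral at viscosity `ν`**: for `λ > 0`, `ν > 0`, `0 ≤ t`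
and a constant `K ≥ 0`,
`∫_{(0,t)} (ν(t-τ))^{-1/2} · (K e^{λτ}) dτ ≤ K ν^{-1/2} · 3 λ^{-1/2} e^{λt}`, together with the
integrability of the integrand (`setIntegral_abelKernel_mul_exp_le`).
[cite: CoiculescuPalasek2025, App. B, Prop. B.1] -/
theorem setIntegral_visc_abelKernel_mul_exp_le {ν t lam K : ℝ} (hν : 0 < ν) (hlam : 0 < lam)
    (ht : 0 ≤ t) (hK : 0 ≤ K) :
    IntegrableOn (fun τ => (ν * (t - τ)) ^ (-(1 / 2 : ℝ)) * (K * Real.exp (lam * τ))) (Ioo 0 t) ∧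
    ∫ τ in Ioo 0 t, (ν * (t - τ)) ^ (-(1 / 2 : ℝ)) * (K * Real.exp (lam * τ)) ≤
      K * ν ^ (-(1 / 2 : ℝ)) * (3 * lam ^ (-(1 / 2 : ℝ)) * Real.exp (lam * t)) := by
  have hk : IntegrableOn (fun τ : ℝ => (t - τ) ^ (-(1 / 2 : ℝ))) (Ioo 0 t) :=
    integrableOn_sub_rpow_Ioo (by norm_num)
  have hexp_cont : Continuous fun τ : ℝ => Real.exp (lam * τ) := by fun_prop
  have hexp_le : ∀ τ ∈ Ioo 0 t, Real.exp (lam * τ) ≤ Real.exp (lam * t) := fun τ hτ =>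
    Real.exp_le_exp.2 (by nlinarith [hτ.2.le])
  -- the integrand, rewritten on `(0, t)`
  have heqOn : EqOn (fun τ => (ν * (t - τ)) ^ (-(1 / 2 : ℝ)) * (K * Real.exp (lam * τ)))
      (fun τ => (K * ν ^ (-(1 / 2 : ℝ))) * ((t - τ) ^ (-(1 / 2 : ℝ)) * Real.exp (lam * (τ - 0))))
      (Ioo 0 t) := by
    intro τ hτ
    simp only [sub_zero]
    rw [visc_abelKernel_eq hν.le hτ.2.le]
    ring
  have hfI : IntegrableOn (fun τ => (t - τ) ^ (-(1 / 2 : ℝ)) * Real.exp (lam * (τ - 0))) (Ioo 0 t) := by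
    refine Integrable.mono' (hk.mul_const (Real.exp (lam * t))) ?_ ?_
    · exact ((measurable_sub_rpow_const t _).aestronglyMeasurable.mul
        (by fun_prop : Continuous fun τ : ℝ => Real.exp (lam * (τ - 0))).aestronglyMeasurable).restrict
    · filter_upwards [ae_restrict_mem measurableSet_Ioo] with τ hτ
      have hk0 : 0 ≤ (t - τ) ^ (-(1 / 2 : ℝ)) := Real.rpow_nonneg (sub_nonneg.2 hτ.2.le) _
      rw [norm_mul, Real.norm_of_nonneg hk0, Real.norm_of_nonneg (Real.exp_pos _).le, sub_zero]
      exact mul_le_mul_of_nonneg_left (hexp_le τ hτ) hk0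
  have hI : IntegrableOn
      (fun τ => (K * ν ^ (-(1 / 2 : ℝ))) * ((t - τ) ^ (-(1 / 2 : ℝ)) * Real.exp (lam * (τ - 0))))
      (Ioo 0 t) := hfI.const_mul _
  refine ⟨hI.congr_fun heqOn.symm measurableSet_Ioo, ?_⟩
  rw [setIntegral_congr_fun measurableSet_Ioo heqOn, integral_const_mul]
  have hA := setIntegral_abelKernel_mul_exp_le (t₀ := 0) (t := t) hlam ht
  simp only [sub_zero] at hA ⊢
  have hKν : 0 ≤ K * ν ^ (-(1 / 2 : ℝ)) := mul_nonneg hK (Real.rpow_nonneg hν.le _)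
  calc K * ν ^ (-(1 / 2 : ℝ)) * ∫ τ in Ioo 0 t, (t - τ) ^ (-(1 / 2 : ℝ)) * Real.exp (lam * τ)
      ≤ K * ν ^ (-(1 / 2 : ℝ)) * (3 * lam ^ (-(1 / 2 : ℝ)) * Real.exp (lam * t)) :=
        mul_le_mul_of_nonneg_left hA hKν
    _ = _ := by ring

end Tools

/-! ### The difference of two heat Duhamel force integrals -/

section ForceDifference

variable {ν t : ℝ} {g g' : ℝ → EuclideanSpace ℝ (Fin 3) → EuclideanSpace ℝ (Fin 3)} {G G' : ℝ}

/-- **Linearity of the heat Duhamel force integral on bounded continuous forces**: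
`∫₀ᵗ e^{ν(t-τ)Δ} g'(τ) dτ − ∫₀ᵗ e^{ν(t-τ)Δ} g(τ) dτ = ∫₀ᵗ e^{ν(t-τ)Δ} (g' − g)(τ) dτ` for jointly
continuous forces bounded on `(0, t)`. [cite: LemarieRieusset2016, Thm. 6.1 (6.12)] -/
theorem forceDuhamel_sub_of_continuous (hν : 0 < ν) (hgc : Continuous (uncurry g))
    (hg'c : Continuous (uncurry g')) (hG : ∀ τ ∈ Ioo 0 t, ∀ y, ‖g τ y‖ ≤ G)
    (hG' : ∀ τ ∈ Ioo 0 t, ∀ y, ‖g' τ y‖ ≤ G') (x : EuclideanSpace ℝ (Fin 3)) :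
    forceDuhamel ν 0 g' t x - forceDuhamel ν 0 g t x =
      forceDuhamel ν 0 (fun τ y => g' τ y - g τ y) t x := by
  have hgslc : ∀ τ, Continuous (g τ) := fun τ => hgc.comp (continuous_const.prodMk continuous_id)
  have hg'slc : ∀ τ, Continuous (g' τ) := fun τ => hg'c.comp (continuous_const.prodMk continuous_id)
  rw [forceDuhamel_apply, forceDuhamel_apply, forceDuhamel_apply,
    ← integral_sub (integrableOn_forceDuhamelIntegrand_slice hν hg'c.stronglyMeasurable hG' x)
      (integrableOn_forceDuhamelIntegrand_slice hν hgc.stronglyMeasurable hG x)]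
  refine setIntegral_congr_fun measurableSet_Ioo fun τ hτ => ?_
  have hσ : 0 < ν * (t - τ) := mul_pos hν (sub_pos.2 hτ.2)
  exact (UnboundedOperators.heatExtension_sub_of_bound (hg'slc τ) (hgslc τ) (hG' τ hτ) (hG τ hτ)
    hσ x).symm

/-- **The force integrals of two bounded continuous forces differ by at most `t · sup‖g' − g‖`.**
[cite: LemarieRieusset2016, Thm. 6.1 with Prop. 6.5 (pp. 133–136)] -/
theorem norm_forceDuhamel_sub_le_of_continuous (hν : 0 < ν) (ht : 0 ≤ t)
    (hgc : Continuous (uncurry g)) (hg'c : Continuous (uncurry g'))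
    (hG : ∀ τ ∈ Ioo 0 t, ∀ y, ‖g τ y‖ ≤ G) (hG' : ∀ τ ∈ Ioo 0 t, ∀ y, ‖g' τ y‖ ≤ G') {Δ : ℝ}
    (hΔ : ∀ τ ∈ Ioo 0 t, ∀ y, ‖g' τ y - g τ y‖ ≤ Δ) (x : EuclideanSpace ℝ (Fin 3)) :
    ‖forceDuhamel ν 0 g' t x - forceDuhamel ν 0 g t x‖ ≤ t * Δ := by
  rw [forceDuhamel_sub_of_continuous hν hgc hg'c hG hG' x]
  have h := norm_forceDuhamel_le (g := fun τ y => g' τ y - g τ y) hν ht hΔ x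
  rwa [sub_zero] at h

end ForceDifference

/-! ### The core estimate -/

section Core

variable {ν T M M' D F : ℝ}
  {g g' u u' : ℝ → EuclideanSpace ℝ (Fin 3) → EuclideanSpace ℝ (Fin 3)}
  {p p' : ℝ → EuclideanSpace ℝ (Fin 3) → ℝ} {G G' : ℝ} {G₂ G₂' : ℝ≥0∞}

/-- **Sup-norm stability of bounded classical finite-energy solutions of the forced Navier–Stokes
system (core form).** Let `(u, p)`, `(u', p')` be classical solutions on `[0, T] × ℝ³`
(`ν > 0`, `T > 0`) driven by jointly continuous forces `g`, `g'` whose slices are bounded, weakly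
divergence free and square integrable (`‖g(τ)‖₂ ≤ G₂ < ∞`, `‖g'(τ)‖₂ ≤ G₂' < ∞`), both of finite
energy and bounded, `‖u‖ ≤ M`, `‖u'‖ ≤ M'` (`M > 0`, `M' > 0`). If `‖u'(0,·) − u(0,·)‖ ≤ D` and the
heat Duhamel integrals of the forces differ by at most `F` on `(0, T]`
(`‖∫₀ᵗ e^{ν(t−τ)Δ} g'(τ) dτ − ∫₀ᵗ e^{ν(t−τ)Δ} g(τ) dτ‖ ≤ F`), then for all `t ∈ [0, T]` and all `x`:
`‖u'(t,x) − u(t,x)‖ ≤ 2 (D + F) exp (36 C₀² (M + M')² t / ν)`, `C₀ = oseenSliceConst ℝ³`.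
[cite: Leray1934, §19 (3.4)–(3.8)] [cite: LemarieRieusset2016, Thm. 6.1 (6.12) with Prop. 6.5]
[cite: OzanskiPooley2018, Lemma 6.5] -/
theorem sup_stability_forced_core (hν : 0 < ν) (hT : 0 < T)
    (hcl : IsClassicalNSSolutionOn (Icc 0 T) ν g u p)
    (hcl' : IsClassicalNSSolutionOn (Icc 0 T) ν g' u' p')
    (hgc : Continuous (uncurry g)) (hg'c : Continuous (uncurry g'))
    (hG : ∀ τ ∈ Icc 0 T, ∀ y, ‖g τ y‖ ≤ G) (hG' : ∀ τ ∈ Icc 0 T, ∀ y, ‖g' τ y‖ ≤ G')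
    (hgdiv : ∀ τ ∈ Icc 0 T, IsWeaklyDivFree (g τ)) (hg'div : ∀ τ ∈ Icc 0 T, IsWeaklyDivFree (g' τ))
    (hG₂ : G₂ ≠ ⊤) (hG₂' : G₂' ≠ ⊤)
    (hg2 : ∀ τ ∈ Icc 0 T, eLpNorm (g τ) 2 volume ≤ G₂)
    (hg'2 : ∀ τ ∈ Icc 0 T, eLpNorm (g' τ) 2 volume ≤ G₂')
    (hE : ∃ C : ℝ≥0∞, C < ⊤ ∧ ∀ t ∈ Icc 0 T, ∫⁻ x, ‖u t x‖ₑ ^ 2 ≤ C)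
    (hE' : ∃ C : ℝ≥0∞, C < ⊤ ∧ ∀ t ∈ Icc 0 T, ∫⁻ x, ‖u' t x‖ₑ ^ 2 ≤ C)
    (hM : 0 < M) (hM' : 0 < M')
    (hbd : ∀ t ∈ Icc 0 T, ∀ y, ‖u t y‖ ≤ M) (hbd' : ∀ t ∈ Icc 0 T, ∀ y, ‖u' t y‖ ≤ M')
    (hD : ∀ y, ‖u' 0 y - u 0 y‖ ≤ D) (hF0 : 0 ≤ F)
    (hF : ∀ t ∈ Ioc 0 T, ∀ x, ‖forceDuhamel ν 0 g' t x - forceDuhamel ν 0 g t x‖ ≤ F) :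
    ∀ t ∈ Icc 0 T, ∀ x, ‖u' t x - u t x‖ ≤
      2 * (D + F) * Real.exp (36 * oseenSliceConst (EuclideanSpace ℝ (Fin 3)) ^ 2 * (M + M') ^ 2 / ν * t) := by
  -- ### constants
  set C₀ : ℝ := oseenSliceConst (EuclideanSpace ℝ (Fin 3)) with hC₀def
  have hC₀ : 0 < C₀ := oseenSliceConst_pos
  set lam : ℝ := 36 * C₀ ^ 2 * (M + M') ^ 2 / ν with hlam_def
  have hMM : 0 < M + M' := add_pos hM hM'
  have hlam : 0 < lam := by positivity
  have hD0 : 0 ≤ D := (norm_nonneg _).trans (hD 0)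
  -- the key algebraic identity behind the choice of `λ`: `3 C₀ (M+M') (νλ)^{-1/2} = 1/2`
  have hkey : C₀ * (ν ^ (-(1 / 2 : ℝ)) * (3 * lam ^ (-(1 / 2 : ℝ)))) * (M + M') = 1 / 2 := by
    have hνl : ν * lam = (6 * C₀ * (M + M')) ^ 2 := by
      rw [hlam_def]; field_simp; ring
    have h1 : ν ^ (-(1 / 2 : ℝ)) * lam ^ (-(1 / 2 : ℝ)) = (6 * C₀ * (M + M'))⁻¹ := by
      rw [← Real.mul_rpow hν.le hlam.le, hνl, Real.rpow_neg (sq_nonneg _),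
        show ((6 * C₀ * (M + M')) ^ 2) ^ (1 / 2 : ℝ) = 6 * C₀ * (M + M') by
          rw [← Real.sqrt_eq_rpow, Real.sqrt_sq (by positivity)]]
    calc C₀ * (ν ^ (-(1 / 2 : ℝ)) * (3 * lam ^ (-(1 / 2 : ℝ)))) * (M + M')
        = 3 * C₀ * (M + M') * (ν ^ (-(1 / 2 : ℝ)) * lam ^ (-(1 / 2 : ℝ))) := by ring
      _ = 3 * C₀ * (M + M') * (6 * C₀ * (M + M'))⁻¹ := by rw [h1]
      _ = 1 / 2 := by field_simp; ring
  -- ### the difference field and the weighted supremum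
  set w : ℝ → EuclideanSpace ℝ (Fin 3) → EuclideanSpace ℝ (Fin 3) := fun τ y => u' τ y - u τ y
    with hw_def
  have hwbd : ∀ τ ∈ Icc 0 T, ∀ y, ‖w τ y‖ ≤ M' + M := fun τ hτ y =>
    (norm_sub_le _ _).trans (add_le_add (hbd' τ hτ y) (hbd τ hτ y))
  set S : Set ℝ := {r | ∃ τ ∈ Icc 0 T, ∃ y : EuclideanSpace ℝ (Fin 3),
    r = Real.exp (-(lam * τ)) * ‖w τ y‖} with hS_def
  have hSbdd : BddAbove S := by
    refine ⟨M' + M, ?_⟩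
    rintro r ⟨τ, hτ, y, rfl⟩
    have he : Real.exp (-(lam * τ)) ≤ 1 := by
      rw [Real.exp_le_one_iff]; nlinarith [hτ.1]
    calc Real.exp (-(lam * τ)) * ‖w τ y‖ ≤ 1 * (M' + M) :=
          mul_le_mul he (hwbd τ hτ y) (norm_nonneg _) zero_le_one
      _ = M' + M := one_mul _
  have h0I : (0 : ℝ) ∈ Icc 0 T := ⟨le_rfl, hT.le⟩
  have hSne : S.Nonempty := ⟨_, 0, h0I, 0, rfl⟩
  set A : ℝ := sSup S with hA_def
  have hA0 : 0 ≤ A := by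
    have hmem : Real.exp (-(lam * 0)) * ‖w 0 0‖ ∈ S := ⟨0, h0I, 0, rfl⟩
    exact le_trans (mul_nonneg (Real.exp_pos _).le (norm_nonneg _)) (le_csSup hSbdd hmem)
  have hwA : ∀ τ ∈ Icc 0 T, ∀ y, ‖w τ y‖ ≤ A * Real.exp (lam * τ) := by
    intro τ hτ y
    have hmem : Real.exp (-(lam * τ)) * ‖w τ y‖ ∈ S := ⟨τ, hτ, y, rfl⟩
    have h1 : Real.exp (-(lam * τ)) * ‖w τ y‖ ≤ A := le_csSup hSbdd hmem
    have h2 := mul_le_mul_of_nonneg_right h1 (Real.exp_pos (lam * τ)).le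
    rwa [mul_assoc, mul_comm ‖w τ y‖, ← mul_assoc, ← Real.exp_add, neg_add_cancel, Real.exp_zero,
      one_mul] at h2
  -- ### slab regularity
  have hslc : ∀ τ ∈ Icc 0 T, Continuous (u τ) := fun τ hτ => (hcl.contDiff_velocity hτ).continuous
  have hslc' : ∀ τ ∈ Icc 0 T, Continuous (u' τ) := fun τ hτ =>
    (hcl'.contDiff_velocity hτ).continuous
  have hmeas : AEStronglyMeasurable (uncurry u)
      ((volume : Measure (ℝ × EuclideanSpace ℝ (Fin 3))).restrict (Ioo 0 T ×ˢ univ)) :=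
    (hcl.smooth_velocity.continuousOn.mono (prod_mono Ioo_subset_Icc_self Subset.rfl)).aestronglyMeasurable
      (measurableSet_Ioo.prod MeasurableSet.univ)
  have hmeas' : AEStronglyMeasurable (uncurry u')
      ((volume : Measure (ℝ × EuclideanSpace ℝ (Fin 3))).restrict (Ioo 0 T ×ˢ univ)) :=
    (hcl'.smooth_velocity.continuousOn.mono (prod_mono Ioo_subset_Icc_self Subset.rfl)).aestronglyMeasurable
      (measurableSet_Ioo.prod MeasurableSet.univ)
  have hmeasw : AEStronglyMeasurable (uncurry w)
      ((volume : Measure (ℝ × EuclideanSpace ℝ (Fin 3))).restrict (Ioo 0 T ×ˢ univ)) :=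
    hmeas'.sub hmeas
  have hbdo : ∀ τ ∈ Ioo 0 T, ∀ y, ‖u τ y‖ ≤ M := fun τ hτ => hbd τ ⟨hτ.1.le, hτ.2.le⟩
  have hbdo' : ∀ τ ∈ Ioo 0 T, ∀ y, ‖u' τ y‖ ≤ M' := fun τ hτ => hbd' τ ⟨hτ.1.le, hτ.2.le⟩
  have hwbdo : ∀ τ ∈ Ioo 0 T, ∀ y, ‖w τ y‖ ≤ M' + M := fun τ hτ => hwbd τ ⟨hτ.1.le, hτ.2.le⟩
  -- ### the pointwise estimate at every `(t, x)` of the slab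
  have hpt : ∀ t ∈ Icc 0 T, ∀ x, Real.exp (-(lam * t)) * ‖w t x‖ ≤ (D + F) + A / 2 := by
    intro t ht x
    rcases ht.1.eq_or_lt with h0 | ht0
    · -- `t = 0`
      rw [← h0, mul_zero, neg_zero, Real.exp_zero, one_mul]
      calc ‖w 0 x‖ ≤ D := hD x
        _ ≤ (D + F) + A / 2 := by linarith
    have htI : t ∈ Ioc 0 T := ⟨ht0, ht.2⟩
    -- the two representations at time `t`
    have hrep := hcl.ae_eq_forced_oseenMild hν hT hgc hG hgdiv hG₂ hg2 hE hM hbd htI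
    have hrep' := hcl'.ae_eq_forced_oseenMild hν hT hg'c hG' hg'div hG₂' hg'2 hE' hM' hbd' htI
    -- the bilinear terms
    have hνt : 0 < ν * t := mul_pos hν ht0
    have hBsplit : ∀ y, oseenDuhamel ν 0 u' u' t y - oseenDuhamel ν 0 u u t y =
        oseenDuhamel ν 0 u' w t y + oseenDuhamel ν 0 w u t y := by
      intro y
      have h1 := oseenDuhamel_sub_right hν hmeas' hmeas' hmeas hbdo' hbdo' hbdo ht0 ht.2 y
      have h2 := oseenDuhamel_sub_left hν hmeas' hmeas hmeas hbdo' hbdo hbdo ht0 ht.2 y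
      change oseenDuhamel ν 0 u' w t y = _ at h1
      change oseenDuhamel ν 0 w u t y = _ at h2
      rw [h1, h2]; abel
    obtain ⟨hIw, hIle⟩ := setIntegral_visc_abelKernel_mul_exp_le (K := A) hν hlam ht.1 hA0
    have hwAo : ∀ τ ∈ Ioo 0 t, ∀ y, ‖w τ y‖ ≤ A * Real.exp (lam * τ) := fun τ hτ =>
      hwA τ ⟨hτ.1.le, hτ.2.le.trans ht.2⟩
    have hB1 : ∀ y, ‖oseenDuhamel ν 0 u' w t y‖ ≤
        C₀ * (M' * (A * ν ^ (-(1 / 2 : ℝ)) * (3 * lam ^ (-(1 / 2 : ℝ)) * Real.exp (lam * t)))) := by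
      intro y
      have hint : IntegrableOn
          (fun τ => (ν * (t - τ)) ^ (-(1 / 2 : ℝ)) * (M' * (A * Real.exp (lam * τ)))) (Ioo 0 t) := by
        have := hIw.const_mul M'
        exact IntegrableOn.congr_fun this (fun τ _ => by ring) measurableSet_Ioo
      refine (norm_oseenDuhamel_le_setIntegral_visc hν
        (fun τ hτ => hbdo' τ ⟨hτ.1, hτ.2.trans_le ht.2⟩) hwAo hint y).trans ?_
      have heq : ∫ τ in Ioo 0 t, (ν * (t - τ)) ^ (-(1 / 2 : ℝ)) * (M' * (A * Real.exp (lam * τ))) =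
          M' * ∫ τ in Ioo 0 t, (ν * (t - τ)) ^ (-(1 / 2 : ℝ)) * (A * Real.exp (lam * τ)) := by
        rw [← integral_const_mul]
        refine setIntegral_congr_fun measurableSet_Ioo fun τ _ => by ring
      rw [heq]
      exact mul_le_mul_of_nonneg_left (mul_le_mul_of_nonneg_left hIle hM'.le) hC₀.le
    have hB2 : ∀ y, ‖oseenDuhamel ν 0 w u t y‖ ≤
        C₀ * ((A * ν ^ (-(1 / 2 : ℝ)) * (3 * lam ^ (-(1 / 2 : ℝ)) * Real.exp (lam * t))) * M) := by
      intro y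
      have hint : IntegrableOn
          (fun τ => (ν * (t - τ)) ^ (-(1 / 2 : ℝ)) * ((A * Real.exp (lam * τ)) * M)) (Ioo 0 t) := by
        have := hIw.mul_const M
        exact IntegrableOn.congr_fun this (fun τ _ => by ring) measurableSet_Ioo
      refine (norm_oseenDuhamel_le_setIntegral_visc hν hwAo
        (fun τ hτ => hbdo τ ⟨hτ.1, hτ.2.trans_le ht.2⟩) hint y).trans ?_
      have heq : ∫ τ in Ioo 0 t, (ν * (t - τ)) ^ (-(1 / 2 : ℝ)) * ((A * Real.exp (lam * τ)) * M) =
          (∫ τ in Ioo 0 t, (ν * (t - τ)) ^ (-(1 / 2 : ℝ)) * (A * Real.exp (lam * τ))) * M := by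
        rw [← integral_mul_const]
        refine setIntegral_congr_fun measurableSet_Ioo fun τ _ => by ring
      rw [heq]
      exact mul_le_mul_of_nonneg_left (mul_le_mul_of_nonneg_right hIle hM.le) hC₀.le
    -- the heat term
    have hH : ∀ y, ‖UnboundedOperators.heatExtension (u' 0) (ν * t) y -
        UnboundedOperators.heatExtension (u 0) (ν * t) y‖ ≤ D := by
      intro y
      rw [← UnboundedOperators.heatExtension_sub_of_bound (hslc' 0 h0I) (hslc 0 h0I) (hbd' 0 h0I)
        (hbd 0 h0I) hνt y]
      exact UnboundedOperators.norm_heatExtension_le hD hνt y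
    -- assemble, a.e. in `x`
    have hbound : (D + F) + A / 2 * Real.exp (lam * t) =
        D + (C₀ * (M' * (A * ν ^ (-(1 / 2 : ℝ)) * (3 * lam ^ (-(1 / 2 : ℝ)) * Real.exp (lam * t)))) +
          C₀ * ((A * ν ^ (-(1 / 2 : ℝ)) * (3 * lam ^ (-(1 / 2 : ℝ)) * Real.exp (lam * t))) * M)) + F := by
      have : C₀ * (M' * (A * ν ^ (-(1 / 2 : ℝ)) * (3 * lam ^ (-(1 / 2 : ℝ)) * Real.exp (lam * t)))) +
          C₀ * ((A * ν ^ (-(1 / 2 : ℝ)) * (3 * lam ^ (-(1 / 2 : ℝ)) * Real.exp (lam * t))) * M) =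
          (C₀ * (ν ^ (-(1 / 2 : ℝ)) * (3 * lam ^ (-(1 / 2 : ℝ)))) * (M + M')) * A * Real.exp (lam * t) := by
        ring
      rw [this, hkey]; ring
    have hae : ∀ᵐ y ∂(volume : Measure (EuclideanSpace ℝ (Fin 3))),
        ‖w t y‖ ≤ (D + F) + A / 2 * Real.exp (lam * t) := by
      filter_upwards [hrep, hrep'] with y hy hy'
      have hwy : w t y = (UnboundedOperators.heatExtension (u' 0) (ν * t) y -
            UnboundedOperators.heatExtension (u 0) (ν * t) y) -
          (oseenDuhamel ν 0 u' u' t y - oseenDuhamel ν 0 u u t y) +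
          (forceDuhamel ν 0 g' t y - forceDuhamel ν 0 g t y) := by
        show u' t y - u t y = _
        rw [hy, hy']; abel
      rw [hwy, hBsplit y, hbound]
      calc ‖UnboundedOperators.heatExtension (u' 0) (ν * t) y -
              UnboundedOperators.heatExtension (u 0) (ν * t) y -
            (oseenDuhamel ν 0 u' w t y + oseenDuhamel ν 0 w u t y) +
            (forceDuhamel ν 0 g' t y - forceDuhamel ν 0 g t y)‖
          ≤ ‖UnboundedOperators.heatExtension (u' 0) (ν * t) y -
              UnboundedOperators.heatExtension (u 0) (ν * t) y -
            (oseenDuhamel ν 0 u' w t y + oseenDuhamel ν 0 w u t y)‖ +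
            ‖forceDuhamel ν 0 g' t y - forceDuhamel ν 0 g t y‖ := norm_add_le _ _
        _ ≤ (‖UnboundedOperators.heatExtension (u' 0) (ν * t) y -
              UnboundedOperators.heatExtension (u 0) (ν * t) y‖ +
            ‖oseenDuhamel ν 0 u' w t y + oseenDuhamel ν 0 w u t y‖) +
            ‖forceDuhamel ν 0 g' t y - forceDuhamel ν 0 g t y‖ := by
            gcongr; exact norm_sub_le _ _
        _ ≤ (D + (‖oseenDuhamel ν 0 u' w t y‖ + ‖oseenDuhamel ν 0 w u t y‖)) + F := by
            gcongr
            · exact hH y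
            · exact norm_add_le _ _
            · exact hF t htI y
        _ ≤ (D + (C₀ * (M' * (A * ν ^ (-(1 / 2 : ℝ)) * (3 * lam ^ (-(1 / 2 : ℝ)) * Real.exp (lam * t)))) +
            C₀ * ((A * ν ^ (-(1 / 2 : ℝ)) * (3 * lam ^ (-(1 / 2 : ℝ)) * Real.exp (lam * t))) * M))) + F := by
            gcongr
            · exact hB1 y
            · exact hB2 y
    have hev : ‖w t x‖ ≤ (D + F) + A / 2 * Real.exp (lam * t) :=
      forall_norm_le_of_ae_norm_le (f := w t) ((hslc' t ht).sub (hslc t ht)) hae x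
    -- multiply by the weight
    have hexp : 0 < Real.exp (-(lam * t)) := Real.exp_pos _
    have hexp1 : Real.exp (-(lam * t)) ≤ 1 := by
      rw [Real.exp_le_one_iff]; nlinarith [ht.1]
    calc Real.exp (-(lam * t)) * ‖w t x‖
        ≤ Real.exp (-(lam * t)) * ((D + F) + A / 2 * Real.exp (lam * t)) :=
          mul_le_mul_of_nonneg_left hev hexp.le
      _ = Real.exp (-(lam * t)) * (D + F) + A / 2 * (Real.exp (-(lam * t)) * Real.exp (lam * t)) := by
          ring
      _ = Real.exp (-(lam * t)) * (D + F) + A / 2 := by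
          rw [← Real.exp_add, neg_add_cancel, Real.exp_zero, mul_one]
      _ ≤ 1 * (D + F) + A / 2 := by gcongr
      _ = (D + F) + A / 2 := by rw [one_mul]
  -- ### the weighted supremum is at most `2 (D + F)`
  have hAle : A ≤ (D + F) + A / 2 := by
    refine csSup_le hSne ?_
    rintro r ⟨τ, hτ, y, rfl⟩
    exact hpt τ hτ y
  have hA2 : A ≤ 2 * (D + F) := by linarith
  -- ### conclusion
  intro t ht x
  have h1 := hwA t ht x
  have hlam_t : lam * t = 36 * C₀ ^ 2 * (M + M') ^ 2 / ν * t := by rw [hlam_def]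
  calc ‖u' t x - u t x‖ = ‖w t x‖ := rfl
    _ ≤ A * Real.exp (lam * t) := h1
    _ ≤ 2 * (D + F) * Real.exp (lam * t) :=
        mul_le_mul_of_nonneg_right hA2 (Real.exp_pos _).le
    _ = _ := by rw [hlam_t]

/-- **Sup-norm stability, forces measured in the sup norm**: under the hypotheses of
`sup_stability_forced_core` with `‖g'(τ,·) − g(τ,·)‖ ≤ Δ` on `[0, T]`, for all `t ∈ [0, T]` and
all `x`: `‖u'(t,x) − u(t,x)‖ ≤ 2 (D + T Δ) exp (36 C₀² (M + M')² t / ν)` — Lipschitz dependence of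
the bounded classical solution on the datum (in `L^∞`) and on the force (in `L¹_t L^∞_x`).
[cite: Leray1934, §19 (3.4)–(3.8)] [cite: LemarieRieusset2016, Thm. 6.1 (6.12) with Prop. 6.5] -/
theorem sup_stability_forced (hν : 0 < ν) (hT : 0 < T)
    (hcl : IsClassicalNSSolutionOn (Icc 0 T) ν g u p)
    (hcl' : IsClassicalNSSolutionOn (Icc 0 T) ν g' u' p')
    (hgc : Continuous (uncurry g)) (hg'c : Continuous (uncurry g'))
    (hG : ∀ τ ∈ Icc 0 T, ∀ y, ‖g τ y‖ ≤ G) (hG' : ∀ τ ∈ Icc 0 T, ∀ y, ‖g' τ y‖ ≤ G')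
    (hgdiv : ∀ τ ∈ Icc 0 T, IsWeaklyDivFree (g τ)) (hg'div : ∀ τ ∈ Icc 0 T, IsWeaklyDivFree (g' τ))
    (hG₂ : G₂ ≠ ⊤) (hG₂' : G₂' ≠ ⊤)
    (hg2 : ∀ τ ∈ Icc 0 T, eLpNorm (g τ) 2 volume ≤ G₂)
    (hg'2 : ∀ τ ∈ Icc 0 T, eLpNorm (g' τ) 2 volume ≤ G₂')
    (hE : ∃ C : ℝ≥0∞, C < ⊤ ∧ ∀ t ∈ Icc 0 T, ∫⁻ x, ‖u t x‖ₑ ^ 2 ≤ C)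
    (hE' : ∃ C : ℝ≥0∞, C < ⊤ ∧ ∀ t ∈ Icc 0 T, ∫⁻ x, ‖u' t x‖ₑ ^ 2 ≤ C)
    (hM : 0 < M) (hM' : 0 < M')
    (hbd : ∀ t ∈ Icc 0 T, ∀ y, ‖u t y‖ ≤ M) (hbd' : ∀ t ∈ Icc 0 T, ∀ y, ‖u' t y‖ ≤ M')
    (hD : ∀ y, ‖u' 0 y - u 0 y‖ ≤ D) {Δ : ℝ} (hΔ0 : 0 ≤ Δ)
    (hΔ : ∀ τ ∈ Icc 0 T, ∀ y, ‖g' τ y - g τ y‖ ≤ Δ) :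
    ∀ t ∈ Icc 0 T, ∀ x, ‖u' t x - u t x‖ ≤
      2 * (D + T * Δ) *
        Real.exp (36 * oseenSliceConst (EuclideanSpace ℝ (Fin 3)) ^ 2 * (M + M') ^ 2 / ν * t) := by
  refine sup_stability_forced_core hν hT hcl hcl' hgc hg'c hG hG' hgdiv hg'div hG₂ hG₂' hg2 hg'2 hE
    hE' hM hM' hbd hbd' hD (by positivity) ?_
  intro t ht x
  have h := norm_forceDuhamel_sub_le_of_continuous hν ht.1.le hgc hg'c
    (fun τ hτ => hG τ ⟨hτ.1.le, hτ.2.le.trans ht.2⟩)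
    (fun τ hτ => hG' τ ⟨hτ.1.le, hτ.2.le.trans ht.2⟩)
    (fun τ hτ => hΔ τ ⟨hτ.1.le, hτ.2.le.trans ht.2⟩) x
  exact h.trans (mul_le_mul_of_nonneg_right ht.2 hΔ0)

/-- **Sup-norm stability of an UNFORCED bounded classical solution under a small force, the force
measured in `L²`**: `(u, p)` unforced (`g = 0`) and `(u', p')` forced by `g'` (jointly continuous,
bounded, weakly divergence-free slices with `‖g'(τ)‖₂ ≤ G₂'`), both classical with finite energy on
`[0, T] × ℝ³` and bounded by `M`, `M'`; if `‖u'(0,·) − u(0,·)‖ ≤ D` then for all `t ∈ [0, T]`, `x`: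
`‖u'(t,x) − u(t,x)‖ ≤ 2 (D + 4 ν^{-3/4} T^{1/4} G₂') exp (36 C₀² (M + M')² t / ν)`. This is the form
in which a force of small `L²` size (e.g. bounded and briefly supported in a fixed ball) is absorbed.
[cite: Leray1934, §19 (3.4)–(3.8)] [cite: Kato1984, (2.3)–(2.4')]
[cite: LemarieRieusset2016, Thm. 6.1 (6.12) with Prop. 6.5] -/
theorem sup_stability_forced_free (hν : 0 < ν) (hT : 0 < T)
    (hcl : IsClassicalNSSolutionOn (Icc 0 T) ν 0 u p)
    (hcl' : IsClassicalNSSolutionOn (Icc 0 T) ν g' u' p')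
    (hg'c : Continuous (uncurry g'))
    (hG' : ∀ τ ∈ Icc 0 T, ∀ y, ‖g' τ y‖ ≤ G')
    (hg'div : ∀ τ ∈ Icc 0 T, IsWeaklyDivFree (g' τ)) {G₂r : ℝ} (hG₂r : 0 ≤ G₂r)
    (hg'2 : ∀ τ ∈ Icc 0 T, eLpNorm (g' τ) 2 volume ≤ ENNReal.ofReal G₂r)
    (hE : ∃ C : ℝ≥0∞, C < ⊤ ∧ ∀ t ∈ Icc 0 T, ∫⁻ x, ‖u t x‖ₑ ^ 2 ≤ C)
    (hE' : ∃ C : ℝ≥0∞, C < ⊤ ∧ ∀ t ∈ Icc 0 T, ∫⁻ x, ‖u' t x‖ₑ ^ 2 ≤ C)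
    (hM : 0 < M) (hM' : 0 < M')
    (hbd : ∀ t ∈ Icc 0 T, ∀ y, ‖u t y‖ ≤ M) (hbd' : ∀ t ∈ Icc 0 T, ∀ y, ‖u' t y‖ ≤ M')
    (hD : ∀ y, ‖u' 0 y - u 0 y‖ ≤ D) :
    ∀ t ∈ Icc 0 T, ∀ x, ‖u' t x - u t x‖ ≤
      2 * (D + 4 * ν ^ (-(3 / 4 : ℝ)) * T ^ (1 / 4 : ℝ) * G₂r) *
        Real.exp (36 * oseenSliceConst (EuclideanSpace ℝ (Fin 3)) ^ 2 * (M + M') ^ 2 / ν * t) := by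
  have hgc : Continuous (uncurry (0 : ℝ → EuclideanSpace ℝ (Fin 3) → EuclideanSpace ℝ (Fin 3))) :=
    continuous_const
  have hG : ∀ τ ∈ Icc 0 T, ∀ y,
      ‖(0 : ℝ → EuclideanSpace ℝ (Fin 3) → EuclideanSpace ℝ (Fin 3)) τ y‖ ≤ 0 := fun τ _ y => by simp
  have hgdiv : ∀ τ ∈ Icc 0 T,
      IsWeaklyDivFree ((0 : ℝ → EuclideanSpace ℝ (Fin 3) → EuclideanSpace ℝ (Fin 3)) τ) :=
    fun τ _ θ _ => by simp
  have hg2 : ∀ τ ∈ Icc 0 T,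
      eLpNorm ((0 : ℝ → EuclideanSpace ℝ (Fin 3) → EuclideanSpace ℝ (Fin 3)) τ) 2 volume ≤ (0 : ℝ≥0∞) :=
    fun τ _ => by simp
  have hg'slc : ∀ τ, Continuous (g' τ) := fun τ => hg'c.comp (continuous_const.prodMk continuous_id)
  have hg'mem : ∀ τ ∈ Icc 0 T, MemLp (g' τ) 2 volume := fun τ hτ =>
    ⟨(hg'slc τ).aestronglyMeasurable, (hg'2 τ hτ).trans_lt ENNReal.ofReal_lt_top⟩
  refine sup_stability_forced_core hν hT hcl hcl' hgc hg'c hG hG' hgdiv hg'div ENNReal.zero_ne_top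
    ENNReal.ofReal_ne_top hg2 hg'2 hE hE' hM hM' hbd hbd' hD (by positivity) ?_
  intro t ht x
  have h0 : forceDuhamel ν 0 (0 : ℝ → EuclideanSpace ℝ (Fin 3) → EuclideanSpace ℝ (Fin 3)) t x = 0 := by
    rw [forceDuhamel_apply]
    have hz : ∀ τ, UnboundedOperators.heatExtension
        ((0 : ℝ → EuclideanSpace ℝ (Fin 3) → EuclideanSpace ℝ (Fin 3)) τ) (ν * (t - τ)) x = 0 := by
      intro τ
      have : ((0 : ℝ → EuclideanSpace ℝ (Fin 3) → EuclideanSpace ℝ (Fin 3)) τ) =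
          fun _ : EuclideanSpace ℝ (Fin 3) => (0 : EuclideanSpace ℝ (Fin 3)) := rfl
      rw [this, UnboundedOperators.heatExtension_zero_fun]; rfl
    simp_rw [hz, integral_zero]
  rw [h0, sub_zero]
  refine (norm_forceDuhamel_le_of_eLpNorm_two hν ht.1 hG₂r
    (fun τ hτ => hg'mem τ ⟨hτ.1.le, hτ.2.le.trans ht.2⟩)
    (fun τ hτ => hg'2 τ ⟨hτ.1.le, hτ.2.le.trans ht.2⟩) x).trans ?_
  have ht4 : t ^ (1 / 4 : ℝ) ≤ T ^ (1 / 4 : ℝ) := Real.rpow_le_rpow ht.1.le ht.2 (by norm_num)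
  have hν34 : 0 ≤ 4 * ν ^ (-(3 / 4 : ℝ)) := by positivity
  calc 4 * ν ^ (-(3 / 4 : ℝ)) * t ^ (1 / 4 : ℝ) * G₂r ≤ 4 * ν ^ (-(3 / 4 : ℝ)) * T ^ (1 / 4 : ℝ) * G₂r := by
        gcongr

end Core

end Literature.Analysis.FluidPDE

end
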